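import Mathlib.AlgebraicGeometry.Morphisms.FlatRank
import Mathlib.AlgebraicGeometry.Morphisms.Etale
import Literature.AlgebraicGeometry.Motives.AlgPointsFibre
import Literature.AlgebraicGeometry.Motives.AbelianVarietyTorsion
import Literature.AlgebraicGeometry.Motives.Varieties
import HarnessLib

/-!
# Complex points of a fibre of a finite étale cover of rank `k`

Topic: `Literature/AlgebraicGeometry/Motives`, companion to `AlgPointsFibre` (points of the fibre
`T_b` of `q : T → W` over a point `b`) and to the count of geometric points of a finite étale scheme
over a separably closed field (`natCard_specHom_eq_finrank`, `AbelianVarietyTorsion`).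

Let `q : T → W` be a morphism of `ℂ`-schemes and `U ⊆ W` an open subscheme over which `q` is
finite, flat and étale of constant rank `k` (Mathlib's `Scheme.Hom.finrank`, the degree of the
finite locally free morphism `q ∣_ U`, Görtz–Wedhorn I, (12.6.1)). Then for every complex point
`b ∈ W(ℂ)` lying in `U` the fibre `q⁻¹(b) ⊆ T(ℂ)` consists of exactly `k` complex points
(`exists_fin_complexPoints_fibre_of_finite_etale_finrank_eq`). This is the "finite étale locus"
half of the classical statement that a generically finite dominant morphism of degree `k` of
complex varieties has exactly `k` points in a general fibre (Harris, *Algebraic Geometry*,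
Prop. 7.16); it is hypothesis `h4` of the reduction
`Fulton1998_degreeFormula_complexOrientation_of` of Fulton's degree formula for complex
orientations, over the open set produced there.

Proof: the point `b : Spec ℂ → W` factors through `U`; the fibre `G := (q ∣_ U)⁻¹(b) → Spec ℂ`
is a base change of `q ∣_ U`, hence finite, flat, étale of rank `k` (Mathlib
`Scheme.Hom.finrank_pullback_snd`), and it is the scheme-theoretic fibre `T_b = T ×_{W, b} Spec ℂ`
(pasting of pullback squares, Mathlib `isPullback_morphismRestrict`). Its rank is
`dim_ℂ Γ(G, 𝒪_G)` (Görtz–Wedhorn I, Prop. 12.21; here `finrank_eq_finrank_of_isAffine`), so `G`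
has exactly `k` complex points
(`natCard_specHom_eq_finrank`), and the complex points of `T_b` over `ℂ` are the complex points of
`T` over `b` (`AlgPoints.range_fibreOverToPoints`, `AlgPoints.fibreOverToPoints_injective`).
Everything is proved; no named facts.

## Main statements

* `finrank_eq_finrank_of_isAffine`: the rank of a finite flat `G → Spec K`, `G` affine, at any point
  is `dim_K Γ(G, 𝒪_G)`.
* `finite_specHom_and_natCard_eq_of_finrank_eq`: a finite étale `K`-scheme of constant rank `n`
  over a separably closed field `K` has exactly `n` `K`-points.
* `exists_fin_complexPoints_fibre_of_finite_etale_finrank_eq`: the statement above.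

## References

* J. Harris, *Algebraic Geometry: A First Course*, GTM 133 (1992), Prop. 7.16 (degree of a map =
  number of points of a general fibre). [Harris1992]
* U. Görtz, T. Wedhorn, *Algebraic Geometry I: Schemes*, 2nd ed. (2020), §(12.6), (12.6.1) and
  Prop. 12.21 (degree of a finite locally free morphism and its fibres). [GortzWedhorn2020]
* R. Hartshorne, *Algebraic Geometry*, II.3 (fibres of a morphism). [Hartshorne1977]
-/

noncomputable section

open CategoryTheory CategoryTheory.Limits AlgebraicGeometry Order

universe u

namespace Literature.AlgebraicGeometry.Motives

/-! ### Rank and points of a finite étale scheme over a field -/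

/-- **The rank of a finite flat `K`-scheme is the dimension of its global sections.** For
`g : G → Spec K` finite and flat with `G` affine, Mathlib's rank function of `g` takes the value
`dim_K Γ(G, 𝒪_G)` at every point (for the `K`-algebra structure `algebraMapΓ g`): `g` is
`G ≅ Spec Γ(G) → Spec K` (`isoSpec_hom_comp_SpecMap_algebraMapΓ`), the rank of `Spec` of a finite
flat ring map is the rank at the stalk (Mathlib `Scheme.Hom.finrank_SpecMap_eq_finrank`), and over
a field every module is free (Mathlib `Module.rankAtStalk_eq_finrank_of_free`).
[cite: GortzWedhorn2020, (12.6.1) and Prop. 12.21] -/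
theorem finrank_eq_finrank_of_isAffine {K : Type u} [Field K] {G : Scheme.{u}}
    (g : G ⟶ Spec (.of K)) [IsAffine G] [IsFinite g] [Flat g] (y : Spec (.of K)) :
    g.finrank y = letI := (algebraMapΓ g).hom.toAlgebra; Module.finrank K Γ(G, ⊤) := by
  letI := (algebraMapΓ g).hom.toAlgebra
  have hfac : G.isoSpec.hom ≫ Spec.map (algebraMapΓ g) = g :=
    isoSpec_hom_comp_SpecMap_algebraMapΓ g
  haveI : IsFinite (Spec.map (algebraMapΓ g)) := by
    have h : IsFinite (G.isoSpec.hom ≫ Spec.map (algebraMapΓ g)) := by rw [hfac]; infer_instance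
    exact (MorphismProperty.cancel_left_of_respectsIso @IsFinite _ _).mp h
  haveI : Flat (Spec.map (algebraMapΓ g)) := by
    have h : Flat (G.isoSpec.hom ≫ Spec.map (algebraMapΓ g)) := by rw [hfac]; infer_instance
    exact (MorphismProperty.cancel_left_of_respectsIso @Flat _ _).mp h
  have hfin : (algebraMapΓ g).hom.Finite := (IsFinite.SpecMap_iff _).mp inferInstance
  have hflat : (algebraMapΓ g).hom.Flat := Flat.SpecMap_iff.mp inferInstance
  calc g.finrank y
      = (G.isoSpec.hom ≫ Spec.map (algebraMapΓ g)).finrank y := by rw [hfac]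
    _ = (Spec.map (algebraMapΓ g)).finrank y := by rw [Scheme.Hom.finrank_comp_left_of_isIso]
    _ = (algebraMapΓ g).hom.finrank y := by rw [Scheme.Hom.finrank_SpecMap_eq_finrank hfin hflat]
    _ = Module.finrank K Γ(G, ⊤) := by
        simp only [RingHom.finrank, Module.rankAtStalk_eq_finrank_of_free]
        rfl

/-- **A finite étale scheme of rank `n` over a separably closed field has exactly `n` rational
points.** If `g : G → Spec K` is finite, flat and étale of constant rank `n` and `K` is separably
closed, then the `K`-points of `G` over `K` (sections of `g`) form a finite set with `n` elements:
their number is `dim_K Γ(G, 𝒪_G)` (`natCard_specHom_eq_finrank`), which is the rank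
(`finrank_eq_finrank_of_isAffine`); finiteness for `n = 0` because a point of `G` forces rank `≥ 1`
(Mathlib `Scheme.Hom.one_le_finrank_map`). [cite: GortzWedhorn2020, Prop. 12.21] -/
theorem finite_specHom_and_natCard_eq_of_finrank_eq {K : Type u} [Field K] [IsSepClosed K]
    {G : Scheme.{u}} (g : G ⟶ Spec (.of K)) [IsFinite g] [Flat g] [Etale g] {n : ℕ}
    (hn : ∀ y, g.finrank y = n) :
    Finite {x : Spec (.of K) ⟶ G // x ≫ g = Spec.map (CommRingCat.ofHom (algebraMap K K))} ∧
      Nat.card {x : Spec (.of K) ⟶ G // x ≫ g = Spec.map (CommRingCat.ofHom (algebraMap K K))}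
        = n := by
  haveI : IsAffine G := isAffine_of_isAffineHom g
  have hcard : Nat.card
      {x : Spec (.of K) ⟶ G // x ≫ g = Spec.map (CommRingCat.ofHom (algebraMap K K))} = n := by
    rw [natCard_specHom_eq_finrank g K]
    exact (finrank_eq_finrank_of_isAffine g (IsLocalRing.closedPoint K)).symm.trans (hn _)
  refine ⟨?_, hcard⟩
  rcases Nat.eq_zero_or_pos n with hn0 | hn0
  · haveI : IsEmpty
        {x : Spec (.of K) ⟶ G // x ≫ g = Spec.map (CommRingCat.ofHom (algebraMap K K))} :=
      ⟨fun x ↦ by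
        have h1 := g.one_le_finrank_map (x.1 (IsLocalRing.closedPoint K))
        rw [hn, hn0] at h1
        exact Nat.not_succ_le_zero 0 h1⟩
    infer_instance
  · exact Nat.finite_of_card_ne_zero (by rw [hcard]; exact hn0.ne')

/-! ### Complex points of a fibre over the finite étale locus -/

/-- **Complex points of a fibre of a finite étale cover of rank `k`.** Let `q : T → W` be a
morphism of (smooth projective) `ℂ`-schemes and `U ⊆ W` an open subscheme over which `q` is finite,
flat and étale of constant rank `k`. Then for every complex point `b` of `W` lying in `U`, the
complex points of `T` over `b` are `k` in number: `q⁻¹(b) = {v 0, …, v (k-1)}` with the `v i`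
pairwise distinct. (Harris, Prop. 7.16: over the locus where a generically finite map of degree
`k` is finite étale, every fibre has exactly `k` points; Görtz–Wedhorn I, Prop. 12.21 for the
degree of a finite locally free morphism along a fibre.) Proof: `b` factors through `U`, the fibre
`(q ∣_ U)⁻¹(b) → Spec ℂ` is finite étale of rank `k` (base change) and is the fibre `T_b`
(Mathlib `isPullback_morphismRestrict`), so it has `k` complex points
(`finite_specHom_and_natCard_eq_of_finrank_eq`), which are the complex points of `T` over `b`
(`AlgPoints.range_fibreOverToPoints`). The smoothness hypotheses are not used.
[cite: Harris1992, Prop. 7.16] [cite: GortzWedhorn2020, Prop. 12.21] -/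
theorem exists_fin_complexPoints_fibre_of_finite_etale_finrank_eq :
    ∀ ⦃d : ℕ⦄ ⦃T W : SchemeOver ℂ⦄ (_hT : IsSmoothProjective d T)
      (_hW : IsSmoothProjective d W) (q : T ⟶ W) (U : W.left.Opens) [IsFinite (q.left ∣_ U)]
      [Flat (q.left ∣_ U)] [Etale (q.left ∣_ U)] ⦃k : ℕ⦄, (∀ u : ↥U, (q.left ∣_ U).finrank u = k) →
      ∀ b : ComplexPoints W, b.pt ∈ U →
        ∃ v : Fin k → ComplexPoints T, Function.Injective v ∧
          (AlgPoints.map q) ⁻¹' {b} = Set.range v := by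
  intro d T W _ _ q U _ _ _ k hrank b hb
  -- (1) the point `b : Spec ℂ → W` factors through `U`
  have hrange : Set.range b.left.base ⊆ Set.range U.ι.base := by
    rintro _ ⟨a, rfl⟩
    rw [Scheme.Opens.range_ι,
      Subsingleton.elim (α := PrimeSpectrum ℂ) a (IsLocalRing.closedPoint ℂ)]
    exact hb
  obtain ⟨b', hb'⟩ : ∃ b' : Spec (.of ℂ) ⟶ (U : Scheme), b' ≫ U.ι = b.left :=
    ⟨IsOpenImmersion.lift U.ι b.left hrange, IsOpenImmersion.lift_fac _ _ _⟩
  -- (2) the fibre `G := (q ∣_ U)⁻¹(b')`, finite étale of rank `k` over `Spec ℂ`, is the fibre `T_b`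
  have hsq : IsPullback (pullback.fst (q.left ∣_ U) b' ≫ (q.left ⁻¹ᵁ U).ι)
      (pullback.snd (q.left ∣_ U) b') q.left b.left := by
    have h := (IsPullback.of_hasPullback (q.left ∣_ U) b').paste_horiz
      (isPullback_morphismRestrict q.left U).flip
    rwa [hb'] at h
  have hfr : ∀ y, (pullback.snd (q.left ∣_ U) b').finrank y = k := fun y ↦ by
    rw [Scheme.Hom.finrank_pullback_snd]
    exact hrank _
  obtain ⟨hfin, hcard⟩ :=
    finite_specHom_and_natCard_eq_of_finrank_eq (pullback.snd (q.left ∣_ U) b') hfr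
  obtain ⟨e, he₁, he₂⟩ : ∃ e : pullback (q.left ∣_ U) b' ≅ pullback q.left b.left,
      e.hom ≫ pullback.snd q.left b.left = pullback.snd (q.left ∣_ U) b' ∧
        e.inv ≫ pullback.snd (q.left ∣_ U) b' = pullback.snd q.left b.left :=
    ⟨hsq.isoPullback, hsq.isoPullback_hom_snd, hsq.isoPullback_inv_snd⟩
  -- (3) `ℂ`-points of `G` over `ℂ` = `ℂ`-points of the `ℂ`-scheme `T_b = fibreOver q b`
  obtain ⟨μ, hμ⟩ : ∃ μ : {x : Spec (.of ℂ) ⟶ pullback (q.left ∣_ U) b' //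
      x ≫ pullback.snd (q.left ∣_ U) b' = Spec.map (CommRingCat.ofHom (algebraMap ℂ ℂ))} →
        AlgPoints (AlgPoints.fibreOver q b) ℂ, Function.Bijective μ := by
    refine ⟨fun x ↦ AlgPoints.mk (x.1 ≫ e.hom)
      ((Category.assoc _ _ _).trans ((congrArg (x.1 ≫ ·) he₁).trans x.2)),
      fun x y h ↦ ?_, fun P ↦ ?_⟩
    · have h' : x.1 ≫ e.hom = y.1 ≫ e.hom := congrArg CommaMorphism.left h
      exact Subtype.ext ((cancel_mono e.hom).mp h')
    · refine ⟨⟨P.left ≫ e.inv,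
        (Category.assoc _ _ _).trans ((congrArg (P.left ≫ ·) he₂).trans (Over.w P))⟩,
        Over.OverMorphism.ext ?_⟩
      exact (Category.assoc _ _ _).trans
        ((congrArg (P.left ≫ ·) e.inv_hom_id).trans (Category.comp_id _))
  haveI := hfin
  haveI : Finite (AlgPoints (AlgPoints.fibreOver q b) ℂ) := Finite.of_surjective μ hμ.2
  have hcard' : Nat.card (AlgPoints (AlgPoints.fibreOver q b) ℂ) = k :=
    (Nat.card_eq_of_bijective μ hμ).symm.trans hcard
  -- (4) enumerate, and push to `T(ℂ)`: the points of `T_b` over `ℂ` are the points of `T` over `b`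
  let ε : AlgPoints (AlgPoints.fibreOver q b) ℂ ≃ Fin k := Finite.equivFinOfCardEq hcard'
  refine ⟨AlgPoints.fibreOverToPoints q b ∘ ε.symm,
    (AlgPoints.fibreOverToPoints_injective q b).comp ε.symm.injective, ?_⟩
  calc AlgPoints.map q ⁻¹' {b} = {e | AlgPoints.map q e = b} := rfl
    _ = Set.range (AlgPoints.fibreOverToPoints q b) := (AlgPoints.range_fibreOverToPoints q b).symm
    _ = Set.range (AlgPoints.fibreOverToPoints q b ∘ ε.symm) := by
        rw [Set.range_comp, Equiv.range_eq_univ, Set.image_univ]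

end Literature.AlgebraicGeometry.Motives

end
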